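import Summits.ResolutionOfSingularities.ResolutionOfSingularities.Theorems.WeightedInvariantGaloisBaseChangeLocal
import Summits.ResolutionOfSingularities.ResolutionOfSingularities.Theorems.WeightedInvariantIota3SigmaFlagSpecialiseCard
import HarnessLib

/-!
# The polynomial flag condition (★) of `S(X)` base-changes along a trace-descent datum, and flags specialise over the base change
# («(D-c) (2)/(3i)» of res-type-057's finite-residue-field plan, re-routed through the Galois base change; door
# `HypersurfaceCentreConstruction`, stmt-ResolutionOfSingularities-19897; P3 rung (c11σ); (o53-desc′); hand res-L1-w43-stub-3)

Topic: `Summits/ResolutionOfSingularities/ResolutionOfSingularities/Theorems`. Helper for the door item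
`HypersurfaceCentreConstruction` (stmt-ResolutionOfSingularities-19897, route `WeightedInvariant`), line `local-engine` (L W4.3),
def-free.

res-type-057's descent of reached weights along `S → S(X)` (p538474 `FlagReaches.of_genericFibre_of_spec`, p543892
`isTwoFlag_specialises_of_card`) needs MANY residues; for a FINITE residue field one first passes to `S_n = S ⊗_{𝔽_p} 𝔽_{p^n}`
(p576792 `GaloisBaseChange`).  The flag of `S(X)` is presented by polynomials `G₁, G₂ ∈ 𝔪S[X]` satisfying 057's polynomial flag
condition (★) `P₁G₁ + P₂G₂ ∈ 𝔪²S[X] ⇒ Pᵢ ∈ 𝔪S[X]` (p542470 `isTwoFlag_genericFibre_polynomial`); THIS FILE moves (★) to `S_n`: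

* §1 `t_finsetSum`, `t_mem_of_mem_map_pow` — an `S`-linear «trace» `t : S' → S` maps `𝔪^r S'` into `𝔪^r`.
* §2 **`star_baseChange`** — along `φ : S → S'` with `𝔪S' = 𝔪'` and an `S`-LINEAR trace-descent datum `(t, b, c)`
  (`x = Σᵢ φ(t(x bᵢ)) cᵢ`), (★) for `(G₁, G₂)` over `S` implies (★) for `(G₁^φ, G₂^φ)` over `S'` (coefficientwise trace
  `Tp : S'[X] → S[X]`, `Tp(P · Q^φ) = Tp(P) · Q`).
* §3 `isTwoFlag_specialises_of_card_of_star` — 057's p543892 with the hypothesis «`(G₁/1, G₂/1)` is a two-flag of `S(X)`»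
  replaced by its polynomial consequence (★) (+ `Gᵢ ∈ 𝔪S[X]`), which is all its proof uses.
* §4 `exists_linear_traceDatum` — the datum of p571864 `TraceDescent.exists_traceDatum` for `A ⊗_k L` IS `A`-linear and additive.

[OURS · L1 W4.3 · (o53-desc′) finite residue field]  Replaces the role of NO printed item; NOT a statement of the manuscript
[claim: Hironaka2017, status: under-review]. AI work, weaker than expert review.  No named facts.

## References

* H. Hironaka, *Characteristic polyhedra of singularities*, J. Math. Kyoto Univ. 7 (1967), §3. [Hironaka1967]
* A. Grothendieck, *EGA IV*, Publ. Math. IHÉS 20 (1964), 0_IV (19.7.1). [EGA0IV]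
-/

noncomputable section

open IsLocalRing Polynomial Literature.AlgebraicGeometry.Resolution
open Summit.ResolutionOfSingularities.ResolutionOfSingularities.Cruxes.HypersurfaceCentreConstruction.LocalEngine
open Summit.ResolutionOfSingularities.ResolutionOfSingularities.Cruxes.HypersurfaceCentreConstruction.LocalEngine.Iota3
open scoped TensorProduct

set_option linter.dupNamespace false -- mandated namespace of this single-conjunct summit

namespace Summit.ResolutionOfSingularities.ResolutionOfSingularities.Theorems

namespace StarBaseChange

/-! ## §1 An `S`-linear trace maps `𝔪^r S'` into `𝔪^r` -/

section Linear

variable {S S' : Type} [CommRing S] [CommRing S'] [Algebra S S']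

omit [Algebra S S'] in
/-- An additive `t` commutes with finite sums. [folklore] -/
theorem t_finsetSum {t : S' → S} (htadd : ∀ x y, t (x + y) = t x + t y) (ht0 : t 0 = 0) {ι : Type*} (s : Finset ι)
    (g : ι → S') : t (∑ i ∈ s, g i) = ∑ i ∈ s, t (g i) := by
  classical
  induction s using Finset.induction_on with
  | empty => simp [ht0]
  | insert a s ha ih => rw [Finset.sum_insert ha, Finset.sum_insert ha, htadd, ih]

/-- An `S`-linear additive `t : S' → S` maps the extension `I S'` of an ideal `I ⊆ S` back into `I`. [folklore] -/
theorem t_mem_of_mem_map {t : S' → S} (htadd : ∀ x y, t (x + y) = t x + t y)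
    (htlin : ∀ (s : S) (y : S'), t (algebraMap S S' s * y) = s * t y) (I : Ideal S) {y : S'}
    (hy : y ∈ I.map (algebraMap S S')) : t y ∈ I := by
  have hy' : y ∈ (I • ⊤ : Submodule S S') := by
    rw [Ideal.smul_top_eq_map]; exact hy
  refine Submodule.smul_induction_on hy' (fun m hm x _ => ?_) (fun x y hx hy => ?_)
  · rw [Algebra.smul_def, htlin]
    exact I.mul_mem_right _ hm
  · rw [htadd]; exact I.add_mem hx hy

end Linear

/-! ## §2 (★) base-changes along an `S`-linear trace-descent datum -/

section Star

variable {S S' : Type} [CommRing S] [CommRing S'] [IsLocalRing S] [IsLocalRing S'] [Algebra S S']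

/-- **(★) BASE-CHANGES.**  `φ : S → S'` with `𝔪_S S' = 𝔪_{S'}`, an additive `S`-linear `t : S' → S` and families `b, c` with the
reproducing identity `x = Σᵢ φ(t(x·bᵢ))·cᵢ`.  If `G₁, G₂ ∈ S[X]` satisfy (★) over `S`, then `G₁^φ, G₂^φ` satisfy (★) over `S'`:
`P₁ G₁^φ + P₂ G₂^φ ∈ 𝔪'²S'[X] ⇒ P₁, P₂ ∈ 𝔪'S'[X]`.  Proof: the coefficientwise trace `Tp : S'[X] → S[X]` is additive with
`Tp(P · Q^φ) = Tp(P)·Q` and `Tp(𝔪'²S'[X]) ⊆ 𝔪²S[X]`; apply (★) to `Tp((P₁G₁^φ + P₂G₂^φ)·bᵢ) = Tp(P₁bᵢ)G₁ + Tp(P₂bᵢ)G₂` and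
reassemble the coefficients of `Pₖ` by the reproducing identity. [folklore] -/
theorem star_baseChange (h𝔪 : (maximalIdeal S).map (algebraMap S S') = maximalIdeal S') {t : S' → S}
    (htadd : ∀ x y, t (x + y) = t x + t y) (ht0 : t 0 = 0) (htlin : ∀ (s : S) (y : S'), t (algebraMap S S' s * y) = s * t y)
    {ι : Type*} [Fintype ι] (b c : ι → S') (hdual : ∀ x, x = ∑ i, algebraMap S S' (t (x * b i)) * c i)
    {G₁ G₂ : S[X]}
    (hstar : ∀ P₁ P₂ : S[X], P₁ * G₁ + P₂ * G₂ ∈ (maximalIdeal S ^ 2).map (C : S →+* S[X]) →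
      P₁ ∈ (maximalIdeal S).map (C : S →+* S[X]) ∧ P₂ ∈ (maximalIdeal S).map (C : S →+* S[X])) :
    ∀ P₁ P₂ : S'[X], P₁ * G₁.map (algebraMap S S') + P₂ * G₂.map (algebraMap S S') ∈
        (maximalIdeal S' ^ 2).map (C : S' →+* S'[X]) →
      P₁ ∈ (maximalIdeal S').map (C : S' →+* S'[X]) ∧ P₂ ∈ (maximalIdeal S').map (C : S' →+* S'[X]) := by
  classical
  intro P₁ P₂ hrel
  -- the coefficientwise trace
  let Tp : S'[X] → S[X] := fun P => ∑ m ∈ Finset.range (P.natDegree + 1), monomial m (t (P.coeff m))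
  have hcoeff : ∀ (P : S'[X]) (n : ℕ), (Tp P).coeff n = t (P.coeff n) := by
    intro P n
    simp only [Tp, finsetSum_coeff, coeff_monomial, Finset.sum_ite_eq', Finset.mem_range]
    by_cases hn : n < P.natDegree + 1
    · rw [if_pos hn]
    · rw [if_neg hn, coeff_eq_zero_of_natDegree_lt (by omega), ht0]
  -- `Tp` of an element of `𝔪'^r S'[X]` lies in `𝔪^r S[X]`
  have hTpow : ∀ (r : ℕ) (P : S'[X]), P ∈ (maximalIdeal S' ^ r).map (C : S' →+* S'[X]) →
      Tp P ∈ (maximalIdeal S ^ r).map (C : S →+* S[X]) := by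
    intro r P hP
    rw [Ideal.mem_map_C_iff] at hP ⊢
    intro n
    rw [hcoeff]
    refine t_mem_of_mem_map htadd htlin _ ?_
    rw [Ideal.map_pow, h𝔪]
    exact hP n
  -- `Tp (P · Q^φ) = Tp P · Q`
  have hTmul : ∀ (P : S'[X]) (Q : S[X]), Tp (P * Q.map (algebraMap S S')) = Tp P * Q := by
    intro P Q
    ext n
    rw [hcoeff, coeff_mul, coeff_mul, t_finsetSum htadd ht0]
    refine Finset.sum_congr rfl fun x _ => ?_
    rw [coeff_map, mul_comm, htlin, mul_comm, hcoeff]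
  -- `Tp` is additive
  have hTadd : ∀ P Q : S'[X], Tp (P + Q) = Tp P + Tp Q := by
    intro P Q; ext n; rw [coeff_add, hcoeff, hcoeff, hcoeff, coeff_add, htadd]
  -- apply (★) over `S` to the traces
  have hkey : ∀ i, Tp (P₁ * C (b i)) ∈ (maximalIdeal S).map (C : S →+* S[X]) ∧
      Tp (P₂ * C (b i)) ∈ (maximalIdeal S).map (C : S →+* S[X]) := by
    intro i
    refine hstar _ _ ?_
    rw [← hTmul, ← hTmul, ← hTadd]
    refine hTpow 2 _ ?_
    have : P₁ * C (b i) * G₁.map (algebraMap S S') + P₂ * C (b i) * G₂.map (algebraMap S S') =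
        (P₁ * G₁.map (algebraMap S S') + P₂ * G₂.map (algebraMap S S')) * C (b i) := by ring
    rw [this]
    exact Ideal.mul_mem_right _ _ hrel
  -- reassemble the coefficients of `P₁, P₂`
  have hreass : ∀ (P : S'[X]), (∀ i, Tp (P * C (b i)) ∈ (maximalIdeal S).map (C : S →+* S[X])) →
      P ∈ (maximalIdeal S').map (C : S' →+* S'[X]) := by
    intro P hP
    rw [Ideal.mem_map_C_iff]
    intro n
    rw [hdual (P.coeff n)]
    refine Ideal.sum_mem _ fun i _ => Ideal.mul_mem_right _ _ ?_
    rw [← h𝔪]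
    refine Ideal.mem_map_of_mem _ ?_
    have h1 := (Ideal.mem_map_C_iff.mp (hP i)) n
    rwa [hcoeff, coeff_mul_C] at h1
  exact ⟨hreass P₁ fun i => (hkey i).1, hreass P₂ fun i => (hkey i).2⟩

/-- The membership `Gᵢ ∈ 𝔪S[X]` base-changes. [folklore] -/
theorem map_mem_map_C (h𝔪 : (maximalIdeal S).map (algebraMap S S') = maximalIdeal S') {G : S[X]}
    (hG : G ∈ (maximalIdeal S).map (C : S →+* S[X])) :
    G.map (algebraMap S S') ∈ (maximalIdeal S').map (C : S' →+* S'[X]) := by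
  rw [Ideal.mem_map_C_iff] at hG ⊢
  intro n
  rw [coeff_map, ← h𝔪]
  exact Ideal.mem_map_of_mem _ (hG n)

end Star

/-! ## §3 Specialisation of flags from (★) (057's card argument, hypothesis in polynomial form) -/

section Card

variable {S : Type} [CommRing S] [IsLocalRing S]

/-- **Flags specialise from (★)**: 057's `isTwoFlag_specialises_of_card` (p543892) with its two-flag hypothesis replaced by the
polynomial data `G₁, G₂ ∈ 𝔪S[X]` + (★), which is all the proof uses. [folklore] -/
theorem isTwoFlag_specialises_of_card_of_star [Finite (ResidueField S)] (G₁ G₂ : S[X])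
    (hG₁ : G₁ ∈ (maximalIdeal S).map (C : S →+* S[X])) (hG₂ : G₂ ∈ (maximalIdeal S).map (C : S →+* S[X]))
    (hstar : ∀ P₁ P₂ : S[X], P₁ * G₁ + P₂ * G₂ ∈ (maximalIdeal S ^ 2).map (C : S →+* S[X]) →
      P₁ ∈ (maximalIdeal S).map (C : S →+* S[X]) ∧ P₂ ∈ (maximalIdeal S).map (C : S →+* S[X]))
    (B : Finset (ResidueField S)) (hcard : G₁.natDegree + G₂.natDegree + B.card < Nat.card (ResidueField S)) :
    ∃ a : S, residue S a ∉ B ∧ IsTwoFlag (Polynomial.aeval a G₁) (Polynomial.aeval a G₂) := by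
  classical
  haveI := Fintype.ofFinite (ResidueField S)
  obtain ⟨θ, ψ, hθadd, hθmul, hθsq, hψadd, hψmul, hψsq, A₁, A₂, B₁, B₂, hA₁, hA₂, hB₁, hB₂, hΔ⟩ :=
    exists_minor_ne_zero hG₁ hG₂ hstar
  have hdeg := natDegree_minor_le hθmul hψmul hA₁ hA₂ hB₁ hB₂
  have hT : (B ∪ (A₁ * B₂ - A₂ * B₁).roots.toFinset).card < Fintype.card (ResidueField S) := by
    rw [← Nat.card_eq_fintype_card]
    refine lt_of_le_of_lt ((Finset.card_union_le _ _).trans ?_) hcard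
    have := (Multiset.toFinset_card_le (A₁ * B₂ - A₂ * B₁).roots).trans (Polynomial.card_roots' _)
    omega
  have hT' : (B ∪ (A₁ * B₂ - A₂ * B₁).roots.toFinset).card < (Finset.univ : Finset (ResidueField S)).card := by
    rwa [Finset.card_univ]
  obtain ⟨r, -, hr⟩ := Finset.exists_mem_notMem_of_card_lt_card hT'
  obtain ⟨a, rfl⟩ := IsLocalRing.residue_surjective r
  rw [Finset.mem_union, not_or, Multiset.mem_toFinset, Polynomial.mem_roots hΔ] at hr
  refine ⟨a, hr.1, isTwoFlag_aeval_of_minor_ne_zero hθadd hθmul hθsq hψadd hψmul hψsq hG₁ hG₂ hA₁ hA₂ hB₁ hB₂ ?_⟩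
  intro h0
  apply hr.2
  rw [Polynomial.IsRoot.def, Polynomial.eval_sub, Polynomial.eval_mul, Polynomial.eval_mul]
  exact h0

end Card

/-! ## §4 The trace datum of `A ⊗_k L` is `A`-linear -/

section Tensor

variable (k A L : Type*) [Field k] [CommRing A] [Algebra k A] [Field L] [Algebra k L] [FiniteDimensional k L]

/-- The trace-descent datum of `A ⊗_k L` (`L/k` finite Galois) with the `A`-LINEARITY and additivity of the trace recorded.
[folklore] -/
theorem exists_linear_traceDatum [IsGalois k L] :
    ∃ (t : A ⊗[k] L → A) (ι : Type) (_ : Fintype ι) (b c : ι → A ⊗[k] L),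
      (∀ x y, t (x + y) = t x + t y) ∧ t 0 = 0 ∧ (∀ (s : A) (y : A ⊗[k] L), t (algebraMap A (A ⊗[k] L) s * y) = s * t y) ∧
      (∀ y, algebraMap A (A ⊗[k] L) (t y) =
          ∑ g : L ≃ₐ[k] L, Algebra.TensorProduct.map (AlgHom.id A A) (g : L →ₐ[k] L) y) ∧
      (∀ x, x = ∑ i, algebraMap A (A ⊗[k] L) (t (x * b i)) * c i) := by
  classical
  let t : A ⊗[k] L → A := fun y => TensorProduct.rid k A (LinearMap.lTensor A (Algebra.trace k L) y)
  have ht_add : ∀ x y, t (x + y) = t x + t y := fun x y => by simp only [t, map_add]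
  have ht_zero : t 0 = 0 := by simp only [t, map_zero]
  have ht_tmul : ∀ (a : A) (l : L), t (a ⊗ₜ l) = Algebra.trace k L l • a := fun a l => by
    simp only [t, LinearMap.lTensor_tmul, TensorProduct.rid_tmul]
  have ht_lin : ∀ (s : A) (y : A ⊗[k] L), t (algebraMap A (A ⊗[k] L) s * y) = s * t y := by
    intro s y
    induction y using TensorProduct.induction_on with
    | zero => simp only [mul_zero, ht_zero]
    | tmul a l =>
      rw [Algebra.TensorProduct.algebraMap_apply, Algebra.algebraMap_self, RingHom.id_apply,
        Algebra.TensorProduct.tmul_mul_tmul, one_mul, ht_tmul, ht_tmul, mul_smul_comm]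
    | add x y hx hy => rw [mul_add, ht_add, ht_add, hx, hy, mul_add]
  let e := Module.finBasis k L
  let es := (Algebra.traceForm k L).dualBasis (traceForm_nondegenerate k L) e
  refine ⟨t, Fin (Module.finrank k L), inferInstance, fun i => 1 ⊗ₜ e i, fun i => 1 ⊗ₜ es i, ht_add, ht_zero, ht_lin,
    fun y => ?_, fun x => ?_⟩
  · induction y using TensorProduct.induction_on with
    | zero => simp only [ht_zero, map_zero, Finset.sum_const_zero]
    | tmul a l =>
      rw [ht_tmul, Algebra.TensorProduct.algebraMap_apply, Algebra.algebraMap_self, RingHom.id_apply,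
        TensorProduct.smul_tmul, Algebra.smul_def, mul_one, trace_eq_sum_automorphisms, TensorProduct.tmul_sum]
      refine Finset.sum_congr rfl fun g _ => ?_
      rw [Algebra.TensorProduct.map_tmul, AlgHom.coe_id, id]
      rfl
    | add x y hx hy => simp only [ht_add, map_add, hx, hy, Finset.sum_add_distrib]
  · induction x using TensorProduct.induction_on with
    | zero => simp only [zero_mul, ht_zero, map_zero, Finset.sum_const_zero]
    | tmul a l =>
      have hrep : ∀ i, Algebra.trace k L (l * e i) = es.repr l i := fun i => by
        rw [LinearMap.BilinForm.dualBasis_repr_apply, Algebra.traceForm_apply]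
      conv_lhs => rw [← es.sum_repr l, TensorProduct.tmul_sum]
      refine Finset.sum_congr rfl fun i _ => ?_
      rw [Algebra.TensorProduct.tmul_mul_tmul, mul_one, ht_tmul, Algebra.TensorProduct.algebraMap_apply,
        Algebra.algebraMap_self, RingHom.id_apply, Algebra.TensorProduct.tmul_mul_tmul, mul_one, one_mul,
        TensorProduct.smul_tmul, hrep]
    | add x y hx hy =>
      conv_lhs => rw [hx, hy]
      rw [← Finset.sum_add_distrib]
      refine Finset.sum_congr rfl fun i _ => ?_
      rw [add_mul, ht_add, map_add, add_mul]

end Tensor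

end StarBaseChange

end Summit.ResolutionOfSingularities.ResolutionOfSingularities.Theorems

end
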